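import Literature.Topology.FourManifolds.ExpansionInduction
import Literature.Topology.FourManifolds.SingularFamily
import Literature.Topology.FourManifolds.MicroPrism
import HarnessLib

/-!
# Engulfing one prism cell through its staircase expansions

The block step of the (refined) engulfing induction for Rushing's Topological Engulfing
Theorem 4.12.1 (T. B. Rushing, *Topological embeddings* (1973), proof of Thm. 4.12.1, Fact 2,
in the codimension-three-safe form of p. 205: only faces with at most `n - 2` vertices are
tracked), for ONE prism cell `conv τ × [u, u']` of the product complex in a chart `ψ : E → M`:
given

* the PL data in general position (`plMap K g` on a finite complex `K` in `E × ℝ`,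
  `RelGenPos`, `PLGeneralPosition.lean`), `K` containing all prism faces over the nonempty
  `ρ ⊆ τ` of the slab `[u, u']`,
* a compact tracked set `T` with the track map `β` (continuous on `T`) and a down-closed family
  `𝒢₀` of tracked faces of `K` with `≤ n - 2` vertices, `|𝒢₀| ⊆ T`, on whose polyhedron and on
  the cell `β = ψ ∘ plMap K g`, such that every tracked point whose image meets the image of the
  cell lies in `|𝒢₀|` (the *separation* of the far part of the track from the cell, arranged by
  the approximation step), the horn `conv τ × {u} ∪ ∂conv τ × [u, u']` of the cell inside `|𝒢₀|`,
  no staircase simplex of the cell and no free face in `𝒢₀`, a compact `C'` off the image of the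
  cell,
* the inductive hypothesis on the dimension in the chart `ψ` (`hIH`, in the form of
  `ExpansionInduction.lean`), and a compactly supported homeomorphism `H₀`, fixing `C' ∪ Φ`
  (`Φ ⊆ β(T)`), with `C' ∪ β(T) ⊆ H₀(U)`,

`exists_homeomorph_expandPrism` produces a compactly supported homeomorphism `H`, fixing
`C' ∪ Φ`, with `C' ∪ β(T) ∪ ψ(plMap K g (|small faces of the prism|)) ⊆ H(U)`, where the *small*
faces are the prism faces with `≤ n - 2` vertices — whose polyhedron contains the tracked part
`prismSkel r τ u u'` of the cell (`prismSkel_subset_facesSpace_small`).  It is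
`exists_homeomorph_expandSeq` (`ExpansionInduction.lean`) along the staircase simplices
`R_0, …, R_k` of the cell (`MicroPrism.lean`), the tracked family growing by the faces of the
`R_i` with `≤ n - 2` vertices, the singular carriers from `exists_singularFamily`
(`SingularFamily.lean`), the horns from `erase_mem_prevFaces` (`ExpansionOrder.lean`).

Everything is proved; theorems only (no definition, no named fact).

## References

* T. B. Rushing, *Topological embeddings*, Academic Press (1973), proof of Thm. 4.12.1, Fact 2
  and p. 205 (codimension three). [Rushing1973]
-/

open Set Function Module
open _root_.Topology

noncomputable section

namespace Literature.Topology.FourManifolds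

open Literature.Analysis.Convexity

variable {E : Type*} [NormedAddCommGroup E] [NormedSpace ℝ E] [FiniteDimensional ℝ E]
  [DecidableEq E] {M : Type*} [TopologicalSpace M] [T2Space M]

/-! ### Image simplices of the PL map -/

section Images

variable {K : Geometry.SimplicialComplex ℝ (E × ℝ)} {g : E × ℝ → E}

/-- **The image of a closed simplex under the PL map is the closed simplex of the images of its
vertices** (the PL map is affine on the simplex). [folklore] -/
theorem plMap_image_convexHull_eq {s : Finset (E × ℝ)} (hs : s ∈ K.faces) :
    plMap K g '' convexHull ℝ (s : Set (E × ℝ)) = convexHull ℝ ((s.image g : Finset E) : Set E) := by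
  classical
  have heq : plMap K g '' convexHull ℝ (s : Set (E × ℝ)) =
      interp s (K.indep hs) g '' convexHull ℝ (s : Set (E × ℝ)) :=
    image_congr fun x hx => plMap_eqOn_interp hs hx
  rw [heq, AffineMap.image_convexHull, Finset.coe_image]
  congr 1
  exact image_congr fun v hv => interp_apply_of_mem (K.indep hs) g hv

omit [FiniteDimensional ℝ E] in
/-- **Image simplices of faces in general position are affinely independent.** [folklore] -/
theorem affineIndependent_coe_image_of_affIndOn {s : Finset (E × ℝ)} (h : AffIndOn g s) :
    AffineIndependent ℝ ((↑) : ↥(s.image g) → E) := by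
  have h1 := (affIndOn_iff.1 h).range
  have h2 : Set.range (fun v : ↥s => g (v : E × ℝ)) = ((s.image g : Finset E) : Set E) := by
    rw [range_restrict_finset_eq_image, Finset.coe_image]
  rw [h2] at h1
  exact h1

omit [NormedAddCommGroup E] [NormedSpace ℝ E] [FiniteDimensional ℝ E] in
/-- Erasing commutes with taking images for an injective vertex map. [folklore] -/
theorem image_erase_of_injOn {s : Finset (E × ℝ)} (h : InjOn g s) {q : E × ℝ} (hq : q ∈ s) :
    (s.erase q).image g = (s.image g).erase (g q) := by
  ext y
  simp only [Finset.mem_image, Finset.mem_erase]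
  constructor
  · rintro ⟨v, ⟨hvq, hv⟩, rfl⟩
    exact ⟨fun h' => hvq (h hv hq h'), v, hv, rfl⟩
  · rintro ⟨hyq, v, hv, rfl⟩
    exact ⟨v, ⟨fun h' => hyq (by rw [h']), hv⟩, rfl⟩

end Images

/-! ### The small faces of a prism and its tracked part -/

section Small

omit [NormedAddCommGroup E] [NormedSpace ℝ E] [FiniteDimensional ℝ E] in
/-- A prism face over a duplicate-free list has at most one vertex more than the list.
[folklore] -/
theorem card_le_of_mem_prismFaces {u u' : ℝ} (l : List E) {F : Finset (E × ℝ)}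
    (hF : F ∈ prismFaces u u' l) : F.card ≤ l.length + 1 := by
  classical
  obtain ⟨-, i, hi, hFi⟩ := hF
  refine (Finset.card_le_card hFi).trans ?_
  unfold stair
  refine (Finset.card_union_le _ _).trans ?_
  have h1 : ((l.take (i + 1)).map (liftV u')).toFinset.card ≤ i + 1 :=
    (List.toFinset_card_le _).trans (by rw [List.length_map, List.length_take]; omega)
  have h2 : ((l.drop i).map (liftV u)).toFinset.card ≤ l.length - i :=
    (List.toFinset_card_le _).trans (by rw [List.length_map, List.length_drop])
  omega

omit [FiniteDimensional ℝ E] in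
/-- **Points of the tracked part of a cell lie in small faces inside the tracked part.** For a
prism over `τ = l.toFinset` with `l.length ≤ r + 1 ≤ n - 2`, every point of `prismSkel r τ u u'`
(the whole cell if `τ.card ≤ r`, else bottom, top and walls) lies in a closed prism face with at
most `n - 2` vertices whose closed simplex is contained in `prismSkel r τ u u'`.
[cite: Rushing1973, p. 205 (codimension three)] -/
theorem exists_small_face_of_mem_prismSkel {n r : ℕ} (hr : r + 3 ≤ n) (l : List E) (hl : l.Nodup)
    (hlen : l.length ≤ r + 1) {u u' : ℝ} (huu' : u < u') {p : E × ℝ}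
    (hp : p ∈ prismSkel r l.toFinset u u') :
    ∃ F ∈ prismFaces u u' l, F.card ≤ n - 2 ∧ p ∈ convexHull ℝ (F : Set (E × ℝ)) ∧
      convexHull ℝ (F : Set (E × ℝ)) ⊆ prismSkel r l.toFinset u u' := by
  classical
  have hcardτ : l.toFinset.card = l.length := List.toFinset_card_of_nodup hl
  -- levels `s ∈ {u, u'}`: the simplex of all `s`-copies
  have hlevel : ∀ s : ℝ, (∀ F : Finset (E × ℝ), F ⊆ bottomSimplex s l → F.Nonempty → F ∈ prismFaces u u' l) →
      ∀ q ∈ prismLevel l.toFinset s, ∃ F ∈ prismFaces u u' l, F.card ≤ n - 2 ∧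
        q ∈ convexHull ℝ (F : Set (E × ℝ)) ∧ convexHull ℝ (F : Set (E × ℝ)) ⊆ prismLevel l.toFinset s := by
    intro s hmem q hq
    obtain ⟨hx, hs⟩ := hq
    rw [mem_singleton_iff] at hs
    have hne : l ≠ [] := by rintro rfl; simp at hx
    obtain ⟨v, rest, hl'⟩ := List.exists_cons_of_ne_nil hne
    have hFne : (bottomSimplex s l).Nonempty :=
      ⟨liftV s v, mem_bottomSimplex.2 ⟨v, by rw [hl']; exact List.mem_cons_self, rfl⟩⟩
    refine ⟨bottomSimplex s l, hmem _ Finset.Subset.rfl hFne, ?_, mem_convexHull_bottomSimplex hx hs, ?_⟩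
    · refine (List.toFinset_card_le _).trans ?_
      rw [List.length_map]
      omega
    · refine convexHull_min (fun w hw => ?_) ((convex_convexHull ℝ _).prod (convex_singleton s))
      obtain ⟨v', hv', rfl⟩ := mem_bottomSimplex.1 hw
      exact ⟨subset_convexHull ℝ _ (List.mem_toFinset.2 hv'), rfl⟩
  by_cases hc : l.toFinset.card ≤ r
  · -- low-dimensional cell: every prism face is small, inside the cell
    have hskel : prismSkel r l.toFinset u u' = prismCell l.toFinset u u' := if_pos hc
    rw [hskel] at hp ⊢
    have hp' : p ∈ prismSet u u' l := ⟨hp.1, hp.2⟩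
    rw [← iUnion_prismFaces_eq huu' l hl] at hp'
    obtain ⟨F, hF, hpF⟩ := mem_iUnion₂.1 hp'
    refine ⟨F, hF, ?_, hpF, convexHull_subset_prismCell_of_mem_prismFaces huu' hl hF⟩
    have := card_le_of_mem_prismFaces l hF
    rw [hcardτ] at hc
    omega
  · -- top-dimensional cell: bottom, top and walls
    have hskel : prismSkel r l.toFinset u u' = prismBdry l.toFinset u u' := if_neg hc
    rw [hskel] at hp ⊢
    rcases hp with (hp | hp) | hp
    · obtain ⟨F, hF, hcard, hpF, hsub⟩ :=
        hlevel u (fun F hF hne => mem_prismFaces_of_subset_bottomSimplex hF hne) p hp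
      exact ⟨F, hF, hcard, hpF, hsub.trans fun q hq => Or.inl (Or.inl hq)⟩
    · obtain ⟨F, hF, hcard, hpF, hsub⟩ :=
        hlevel u' (fun F hF hne => mem_prismFaces_of_subset_topSimplex hF hne) p hp
      exact ⟨F, hF, hcard, hpF, hsub.trans fun q hq => Or.inl (Or.inr hq)⟩
    · obtain ⟨v, hv, hpv⟩ := mem_iUnion₂.1 hp
      -- the wall over `τ ∖ {v}` is the prism over the filtered list
      set l' : List E := l.filter fun w => w ∈ l.toFinset.erase v with hl'def
      have hl'nd : l'.Nodup := hl.filter _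
      have hl'to : l'.toFinset = l.toFinset.erase v := by
        ext w
        simp only [hl'def, List.mem_toFinset, List.mem_filter, Finset.mem_erase, decide_eq_true_eq]
        tauto
      have hl'len : l'.length + 1 = l.length := by
        rw [← List.toFinset_card_of_nodup hl'nd, hl'to, Finset.card_erase_of_mem hv, hcardτ]
        have := List.length_pos_of_mem (List.mem_toFinset.1 hv)
        omega
      have hp' : p ∈ prismSet u u' l' := by
        refine ⟨?_, hpv.2⟩
        rw [hl'to]
        exact hpv.1
      rw [← iUnion_prismFaces_eq huu' l' hl'nd] at hp'
      obtain ⟨F, hF, hpF⟩ := mem_iUnion₂.1 hp'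
      have hFl : F ∈ prismFaces u u' l := ((prismFaces_filter_iff _ l F).1 hF).1
      refine ⟨F, hFl, ?_, hpF, ?_⟩
      · have := card_le_of_mem_prismFaces l' hF
        omega
      · have h := convexHull_subset_prismCell_of_mem_prismFaces huu' hl'nd hF
        rw [hl'to] at h
        exact h.trans fun q hq => Or.inr (mem_iUnion₂.2 ⟨v, hv, hq⟩)

omit [FiniteDimensional ℝ E] in
/-- **The tracked part of a cell lies in the polyhedron of its small faces.** [cite: Rushing1973, p. 205 (codimension three)] -/
theorem prismSkel_subset_facesSpace_small {n r : ℕ} (hr : r + 3 ≤ n) (l : List E) (hl : l.Nodup)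
    (hlen : l.length ≤ r + 1) {u u' : ℝ} (huu' : u < u') :
    prismSkel r l.toFinset u u' ⊆
      facesSpace {F | F ∈ prismFaces u u' l ∧ F.card ≤ n - 2} := fun p hp => by
  obtain ⟨F, hF, hcard, hpF, -⟩ := exists_small_face_of_mem_prismSkel hr l hl hlen huu' hp
  exact mem_facesSpace_iff.2 ⟨F, ⟨hF, hcard⟩, hpF⟩

end Small

/-! ### Monotonicity of the present faces of one prism -/

section Mono

omit [FiniteDimensional ℝ E] in
/-- The faces present in the one-prism structure increase with the stage. [folklore] -/
theorem prevFaces_mono_onePrism {K : Geometry.SimplicialComplex ℝ E} {L : List E} {t : ℕ → ℝ}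
    {σ : Finset E} {i j : ℕ} (hij : i ≤ j) :
    prevFaces K L t 1 ∅ 0 ∅ σ i ⊆ prevFaces K L t 1 ∅ 0 ∅ σ j := by
  intro F hF
  unfold prevFaces at hF ⊢
  rcases hF with hF | ⟨hne, i', hi', hFi⟩
  · exact Or.inl hF
  · exact Or.inr ⟨hne, i', lt_of_lt_of_le hi' hij, hFi⟩

end Mono

/-! ### The one-prism engulfing step -/

set_option maxHeartbeats 800000 in
/-- **Engulfing one prism cell** (Rushing, proof of Thm. 4.12.1, Fact 2, for one cell
`σ × [t_{a-1}, t_a]` of the refined structure; see the module docstring for the hypotheses).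
The conclusion engulfs `C' ∪ β(T)` together with the `ψ ∘ plMap`-image of the polyhedron of the
prism faces with at most `n - 2` vertices, by a compactly supported homeomorphism fixing
`C' ∪ Φ`. [cite: Rushing1973, proof of Thm. 4.12.1, Fact 2 and p. 205] -/
theorem exists_homeomorph_expandPrism {n r : ℕ} (hr : r + 3 ≤ n) (hn : finrank ℝ E = n)
    (ψ : E → M) (hψ : IsOpenEmbedding ψ) (U : Set M) (hU : IsOpen U)
    (hIH : ∀ (e₀ : M ≃ₜ M) (KP : Geometry.SimplicialComplex ℝ E) (_ : KP.faces.Finite)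
      (KQ : Set (Finset E)) (_ : KQ ⊆ KP.faces) (_ : ∀ s ∈ KQ, ∀ t ⊆ s, t.Nonempty → t ∈ KQ)
      (_ : ∀ s ∈ KP.faces, s.card ≤ n - 2) (_ : ∀ s ∈ KP.faces, s ∉ KQ → s.card ≤ r)
      (_ : ψ '' facesSpace KQ ⊆ e₀ '' U) (C' : Set M) (_ : IsCompact C') (_ : C' ⊆ e₀ '' U),
      ∃ e : M ≃ₜ M, (∀ x ∈ ψ '' facesSpace KQ ∪ C', e x = x) ∧
        (∃ E₀ : Set M, IsCompact E₀ ∧ ∀ x, x ∉ E₀ → e x = x) ∧ ψ '' KP.space ⊆ e '' (e₀ '' U))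
    -- the PL data in general position
    {K : Geometry.SimplicialComplex ℝ (E × ℝ)} (hK : K.faces.Finite) {g : E × ℝ → E}
    {V₀ S : Set (E × ℝ)} (hgp : RelGenPos V₀ S g)
    (hfix : ∀ ρ ∈ K.faces, (ρ : Set (E × ℝ)) ⊆ V₀ → AffIndOn g ρ)
    (hemb : InjOn (plMap K g) (fixedSpace K V₀)) (hS : ∀ F ∈ K.faces, (F : Set (E × ℝ)) ⊆ S)
    -- the prism
    (l : List E) (hl : l.Nodup) (hind : AffineIndependent ℝ ((↑) : ↥l.toFinset → E))
    (hlne : l ≠ []) (hlen : l.length ≤ r + 1) {tl : ℕ → ℝ} (htl : StrictMono tl)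
    (hfacesK : ∀ ρ : Finset E, ρ.Nonempty → ρ ⊆ l.toFinset →
      prismFaces (tl 0) (tl 1) (faceList l ρ) ⊆ K.faces)
    -- the tracked data
    (𝒢₀ : Set (Finset (E × ℝ))) (h𝒢₀K : 𝒢₀ ⊆ K.faces)
    (h𝒢₀down : ∀ G ∈ 𝒢₀, ∀ t ∈ K.faces, t ⊆ G → t ∈ 𝒢₀) (h𝒢₀card : ∀ G ∈ 𝒢₀, G.card ≤ n - 2)
    (T : Set (E × ℝ)) (hTc : IsCompact T) (h𝒢₀T : facesSpace 𝒢₀ ⊆ T)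
    (β : E × ℝ → M) (hβT : ContinuousOn β T)
    (hβK : ∀ p ∈ facesSpace 𝒢₀ ∪ prismCell l.toFinset (tl 0) (tl 1), β p = ψ (plMap K g p))
    (hsep₀ : ∀ z ∈ T, β z ∈ ψ '' (plMap K g '' prismCell l.toFinset (tl 0) (tl 1)) →
      z ∈ facesSpace 𝒢₀)
    (hhorn : prismLevel l.toFinset (tl 0) ∪
      (⋃ v ∈ l.toFinset, prismCell (l.toFinset.erase v) (tl 0) (tl 1)) ⊆ facesSpace 𝒢₀)
    (hnew₀ : ∀ (i : ℕ) (hi : i < l.length), stair (tl 0) (tl 1) l i ∉ 𝒢₀ ∧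
      (stair (tl 0) (tl 1) l i).erase (liftV (tl 0) l[i]) ∉ 𝒢₀)
    (C' : Set M) (hC' : IsCompact C')
    (hC'cell : Disjoint C' (ψ '' (plMap K g '' prismCell l.toFinset (tl 0) (tl 1))))
    (Φ : Set M) (hΦ : Φ ⊆ β '' T)
    -- the current homeomorphism
    (H₀ : M ≃ₜ M) (hH₀fix : ∀ x ∈ C' ∪ Φ, H₀ x = x)
    (hH₀supp : ∃ E₀ : Set M, IsCompact E₀ ∧ ∀ x, x ∉ E₀ → H₀ x = x)
    (hH₀cov : C' ∪ β '' T ⊆ H₀ '' U) :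
    ∃ H : M ≃ₜ M, (∀ x ∈ C' ∪ Φ, H x = x) ∧ (∃ E₀ : Set M, IsCompact E₀ ∧ ∀ x, x ∉ E₀ → H x = x) ∧
      C' ∪ β '' T ∪ ψ '' (plMap K g '' facesSpace {F | F ∈ prismFaces (tl 0) (tl 1) l ∧ F.card ≤ n - 2})
        ⊆ H '' U := by
  classical
  -- notation
  have h01 : tl 0 < tl 1 := htl Nat.one_pos
  set τ : Finset E := l.toFinset with hτdef
  have hcardτ : τ.card = l.length := List.toFinset_card_of_nodup hl
  have hnE : l.length + 1 ≤ finrank ℝ E + 1 := by rw [hn]; omega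
  have hfinE : r + 3 ≤ finrank ℝ E := by rw [hn]; exact hr
  have hτne : τ.Nonempty := by
    obtain ⟨v, rest, rfl⟩ := List.exists_cons_of_ne_nil hlne
    exact ⟨v, by simp [hτdef]⟩
  -- the staircase simplices are faces of `K`
  have hprismK : prismFaces (tl 0) (tl 1) l ⊆ K.faces := by
    have := hfacesK τ hτne Finset.Subset.rfl
    rwa [faceList_toFinset_self] at this
  have hRK : ∀ i < l.length, stair (tl 0) (tl 1) l i ∈ K.faces := fun i hi =>
    hprismK ⟨⟨_, liftV_bot_getElem_mem_stair l i hi⟩, i, hi, Finset.Subset.rfl⟩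
  have hRcell : ∀ i < l.length, convexHull ℝ (stair (tl 0) (tl 1) l i : Set (E × ℝ)) ⊆
      prismCell τ (tl 0) (tl 1) := fun i hi =>
    convexHull_subset_prismCell_of_mem_prismFaces h01 hl ⟨⟨_, liftV_bot_getElem_mem_stair l i hi⟩,
      i, hi, Finset.Subset.rfl⟩
  -- general position on the staircase simplices
  have hRind : ∀ i < l.length, AffIndOn g (stair (tl 0) (tl 1) l i) := fun i hi =>
    affIndOn_of_relGenPos hgp hfix (hRK i hi) (hS _ (hRK i hi))
      ((card_le_of_mem_prismFaces l ⟨⟨_, liftV_bot_getElem_mem_stair l i hi⟩, i, hi,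
        Finset.Subset.rfl⟩).trans hnE)
  -- the present faces of the one-prism structure, restricted to small faces
  set 𝒢loc : ℕ → Set (Finset (E × ℝ)) := fun i =>
    {F | F ∈ prevFaces (simplexCx τ hind) l tl 1 ∅ 0 ∅ τ i ∧ F.card ≤ n - 2} with h𝒢loc
  have h𝒢loc_prism : ∀ i ≤ l.length, ∀ F ∈ 𝒢loc i, F ∈ prismFaces (tl 0) (tl 1) l := by
    intro i hi F hF
    obtain ⟨ρ, hρne, hρτ, hFρ⟩ := exists_of_mem_prevFaces_onePrism l hind hlne hi hF.1
    have := (prismFaces_filter_iff ρ l F).1 (by rwa [faceList] at hFρ)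
    exact this.1
  have h𝒢locK : ∀ i ≤ l.length, 𝒢loc i ⊆ K.faces := fun i hi F hF => hprismK (h𝒢loc_prism i hi F hF)
  have h𝒢loc_mono : ∀ i j, i ≤ j → 𝒢loc i ⊆ 𝒢loc j := fun i j hij F hF =>
    ⟨prevFaces_mono_onePrism hij hF.1, hF.2⟩
  -- all tracked faces at stage `i`
  set 𝒢all : ℕ → Set (Finset (E × ℝ)) := fun i => 𝒢₀ ∪ 𝒢loc i with h𝒢all
  have h𝒢allK : ∀ i ≤ l.length, 𝒢all i ⊆ K.faces := fun i hi =>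
    union_subset h𝒢₀K (h𝒢locK i hi)
  have h𝒢all_fin : ∀ i, i ≤ l.length → (𝒢all i).Finite := fun i hi => hK.subset (h𝒢allK i hi)
  have h𝒢allS : ∀ i ≤ l.length, ∀ G ∈ 𝒢all i, (G : Set (E × ℝ)) ⊆ S := fun i hi G hG =>
    hS G (h𝒢allK i hi hG)
  have h𝒢all_card : ∀ i ≤ l.length, ∀ G ∈ 𝒢all i, G.card + 2 ≤ finrank ℝ E := by
    intro i hi G hG
    rw [hn]
    rcases hG with hG | hG
    · have := h𝒢₀card G hG; omega
    · have := hG.2; omega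
  have h𝒢all_down : ∀ i ≤ l.length, ∀ G ∈ 𝒢all i, ∀ t ∈ K.faces, t ⊆ G → t ∈ 𝒢all i := by
    intro i hi G hG t ht htG
    rcases hG with hG | hG
    · exact Or.inl (h𝒢₀down G hG t ht htG)
    · exact Or.inr ⟨prevFaces_down_closed hG.1 htG (K.nonempty_of_mem_faces ht),
        (Finset.card_le_card htG).trans hG.2⟩
  -- newness of the staircase simplex and of its free face
  have hnewR : ∀ (i : ℕ) (hi : i < l.length), stair (tl 0) (tl 1) l i ∉ 𝒢all i := by
    rintro i hi (h | h)
    · exact (hnew₀ i hi).1 h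
    · exact not_convexHull_stair_subset l hl hind htl i hi fun p hp =>
        mem_facesSpace_iff.2 ⟨_, h.1, hp⟩
  have hnewB : ∀ (i : ℕ) (hi : i < l.length),
      (stair (tl 0) (tl 1) l i).erase (liftV (tl 0) l[i]) ∉ 𝒢all i := by
    rintro i hi (h | h)
    · exact (hnew₀ i hi).2 h
    · exact not_convexHull_eraseBot_subset l hl hind htl i hi fun p hp =>
        mem_facesSpace_iff.2 ⟨_, h.1, hp⟩
  -- the singular families
  have key : ∀ (i : ℕ) (hi : i < l.length), ∃ Asub : ↥(𝒢all i) → AffineSubspace ℝ E,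
      (∀ G, (Asub G : Set E).Nonempty → finrank ℝ (Asub G).direction + 2 ≤ r) ∧
      ∀ x ∈ convexHull ℝ (stair (tl 0) (tl 1) l i : Set (E × ℝ)), ∀ y ∈ facesSpace (𝒢all i),
        plMap K g y = plMap K g x →
        plMap K g x ∈ simplexHorn ((stair (tl 0) (tl 1) l i).image g) (g (liftV (tl 0) l[i])) ∨
          ∃ G, plMap K g x ∈ Asub G := by
    intro i hi
    have hcardR : (stair (tl 0) (tl 1) l i).card ≤ r + 2 :=
      (card_le_of_mem_prismFaces l ⟨⟨_, liftV_bot_getElem_mem_stair l i hi⟩, i, hi,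
        Finset.Subset.rfl⟩).trans (by omega)
    exact exists_singularFamily hgp hfix hemb hfinE (hRK i hi) (hS _ (hRK i hi)) hcardR
      (liftV_bot_getElem_mem_stair l i hi) (𝒢all i) (h𝒢allK i hi.le) (h𝒢allS i hi.le)
      (h𝒢all_card i hi.le) (h𝒢all_down i hi.le) (hnewR i hi) (hnewB i hi)
  choose Af hAfdim hAfsep using key
  -- the data of the expansion sequence
  set Timg : ℕ → Finset E := fun j => if h : j < l.length then (stair (tl 0) (tl 1) l j).image g else ∅
    with hTimg
  set apexI : ℕ → E := fun j => if h : j < l.length then g (liftV (tl 0) l[j]) else 0 with hapexI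
  have hTimg_eq : ∀ j (hj : j < l.length), Timg j = (stair (tl 0) (tl 1) l j).image g := fun j hj => by
    simp only [hTimg, dif_pos hj]
  have hapexI_eq : ∀ j (hj : j < l.length), apexI j = g (liftV (tl 0) l[j]) := fun j hj => by
    simp only [hapexI, dif_pos hj]
  have hconvT : ∀ j (hj : j < l.length), convexHull ℝ (Timg j : Set E) =
      plMap K g '' convexHull ℝ (stair (tl 0) (tl 1) l j : Set (E × ℝ)) := fun j hj => by
    rw [hTimg_eq j hj, plMap_image_convexHull_eq (hRK j hj)]
  -- the tracked compact sets
  set Cseq : ℕ → Set M := fun j => C' ∪ β '' T ∪ ψ '' (plMap K g '' facesSpace (𝒢loc j))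
    with hCseq
  -- compactness
  have hKsp_fs : ∀ i ≤ l.length, facesSpace (𝒢loc i) ⊆ K.space := fun i hi p hp => by
    obtain ⟨F, hF, hpF⟩ := mem_facesSpace_iff.1 hp
    exact K.convexHull_subset_space (h𝒢locK i hi hF) hpF
  have hfs_cpt : ∀ i ≤ l.length, IsCompact (facesSpace (𝒢loc i)) := fun i hi => by
    have : facesSpace (𝒢loc i) = ⋃ F ∈ 𝒢loc i, convexHull ℝ (F : Set (E × ℝ)) := rfl
    rw [this]
    exact (hK.subset (h𝒢locK i hi)).isCompact_biUnion fun F _ =>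
      F.finite_toSet.isCompact_convexHull (𝕜 := ℝ)
  have hβT_cpt : IsCompact (β '' T) := hTc.image_of_continuousOn hβT
  have hCcpt : ∀ j ≤ l.length, IsCompact (Cseq j) := fun j hj =>
    (hC'.union hβT_cpt).union (((hfs_cpt j hj).image_of_continuousOn
      ((continuousOn_plMap hK g).mono (hKsp_fs j hj))).image hψ.continuous)
  -- monotonicity and growth of the tracked sets
  have hCmono : ∀ j < l.length, Cseq j ⊆ Cseq (j + 1) := fun j hj =>
    union_subset_union Subset.rfl (image_mono (image_mono
      (facesSpace_mono (h𝒢loc_mono j (j + 1) (Nat.le_succ j)))))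
  have hCsucc : ∀ j < l.length, Cseq (j + 1) ⊆ Cseq j ∪ ψ '' convexHull ℝ (Timg j : Set E) := by
    intro j hj
    rintro x ((hx | hx) | hx)
    · exact Or.inl (Or.inl (Or.inl hx))
    · exact Or.inl (Or.inl (Or.inr hx))
    · obtain ⟨y, ⟨z, hz, rfl⟩, rfl⟩ := hx
      obtain ⟨F, hF, hzF⟩ := mem_facesSpace_iff.1 hz
      -- `F` is an old present face, or inside `R_j`
      have hF1 := hF.1
      have hsucc := prevFaces_succ (K := simplexCx τ hind) (N := 1) (Sub := ∅) (a := 0) (D := ∅)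
        hl (simplexCx_faces_subset_toFinset l hind) htl (toFinset_mem_simplexCx_faces l hind hlne)
        (i := j) (by rw [faceList_toFinset_self]; exact hj)
      simp only [faceList_toFinset_self] at hsucc
      rw [hsucc, mem_insert_iff, mem_insert_iff] at hF1
      rcases hF1 with rfl | rfl | hF1
      · right
        rw [hconvT j hj]
        exact mem_image_of_mem ψ (mem_image_of_mem _ hzF)
      · right
        rw [hconvT j hj]
        refine mem_image_of_mem ψ (mem_image_of_mem _ ?_)
        exact convexHull_mono (by rw [Finset.coe_erase]; exact sdiff_subset) hzF
      · exact Or.inl (Or.inr (mem_image_of_mem ψ (mem_image_of_mem _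
          (mem_facesSpace_iff.2 ⟨F, ⟨hF1, hF.2⟩, hzF⟩))))
  -- the horns are present
  have hChorn : ∀ j < l.length, ψ '' simplexHorn (Timg j) (apexI j) ⊆ Cseq j := by
    intro j hj
    rw [hTimg_eq j hj, hapexI_eq j hj]
    rintro _ ⟨y, hy, rfl⟩
    obtain ⟨b, hb, hyb⟩ := mem_iUnion₂.1 hy
    obtain ⟨hbne, hbimg⟩ := Finset.mem_erase.1 hb
    obtain ⟨q, hq, rfl⟩ := Finset.mem_image.1 hbimg
    have hqp : q ≠ liftV (tl 0) l[j] := fun h => hbne (by rw [h])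
    have hinj : InjOn g (stair (tl 0) (tl 1) l j) := (hRind j hj).injOn
    rw [← image_erase_of_injOn hinj hq, ← plMap_image_convexHull_eq
      (K.down_closed (hRK j hj) (Finset.erase_subset _ _) ⟨_, Finset.mem_erase.2 ⟨hqp.symm,
        liftV_bot_getElem_mem_stair l j hj⟩⟩)] at hyb
    obtain ⟨z, hz, rfl⟩ := hyb
    -- `R_j ∖ {q}` is a small present face
    have hmem : (stair (tl 0) (tl 1) l j).erase q ∈ 𝒢loc j := by
      refine ⟨?_, ?_⟩
      · have hj' : j < (faceList l l.toFinset).length := by rw [faceList_toFinset_self]; exact hj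
        have h := fun (hq' : q ∈ stair (tl 0) (tl (0 + 1)) (faceList l l.toFinset) j)
            (hqa' : q ≠ liftV (tl 0) (faceList l l.toFinset)[j]) =>
          erase_mem_prevFaces (K := simplexCx τ hind) (N := 1) (Sub := ∅) (a := 0)
            (D := ∅) hl (simplexCx_faces_subset_toFinset l hind) htl
            (toFinset_mem_simplexCx_faces l hind hlne) (i := j) hj' hq' hqa'
        simp only [faceList_toFinset_self] at h
        exact h hq hqp
      · have := card_le_of_mem_prismFaces (u := tl 0) (u' := tl 1) l (F := stair (tl 0) (tl 1) l j)
          ⟨⟨_, liftV_bot_getElem_mem_stair l j hj⟩, j, hj, Finset.Subset.rfl⟩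
        rw [Finset.card_erase_of_mem hq]
        omega
    exact Or.inr (mem_image_of_mem ψ (mem_image_of_mem _ (mem_facesSpace_iff.2 ⟨_, hmem, hz⟩)))
  -- affine independence, apex, free face of the image simplices
  have hTind : ∀ j < l.length, AffineIndependent ℝ ((↑) : ↥(Timg j) → E) := fun j hj => by
    rw [hTimg_eq j hj]
    exact affineIndependent_coe_image_of_affIndOn (hRind j hj)
  have hTa : ∀ j < l.length, apexI j ∈ Timg j := fun j hj => by
    rw [hTimg_eq j hj, hapexI_eq j hj]
    exact Finset.mem_image_of_mem g (liftV_bot_getElem_mem_stair l j hj)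
  have hTB : ∀ j < l.length, ((Timg j).erase (apexI j)).Nonempty := fun j hj => by
    rw [hTimg_eq j hj, hapexI_eq j hj, ← image_erase_of_injOn (hRind j hj).injOn
      (liftV_bot_getElem_mem_stair l j hj)]
    exact (erase_bot_nonempty l h01.ne j hj).image g
  -- the separation property
  have hinjψ : Injective ψ := hψ.injective
  have hsep : ∀ (j : ℕ) (hj : j < l.length), ∀ y ∈ convexHull ℝ (Timg j : Set E), ψ y ∈ Cseq j →
      y ∈ simplexHorn (Timg j) (apexI j) ∨ ∃ ℓ : ↥(𝒢all j), y ∈ Af j hj ℓ := by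
    intro j hj y hy hyC
    rw [hconvT j hj] at hy
    obtain ⟨x, hx, rfl⟩ := hy
    have hxcell : x ∈ prismCell τ (tl 0) (tl 1) := hRcell j hj hx
    -- a tracked point `z` with the same image
    have hz : ∃ z ∈ facesSpace (𝒢all j), plMap K g z = plMap K g x := by
      rcases hyC with (hC | ⟨z, hzT, hzy⟩) | ⟨y', ⟨z, hz, rfl⟩, hzy⟩
      · exact absurd (mem_image_of_mem ψ (mem_image_of_mem (plMap K g) hxcell))
          (disjoint_left.1 hC'cell hC)
      · have hz𝒢 : z ∈ facesSpace 𝒢₀ :=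
          hsep₀ z hzT (hzy ▸ mem_image_of_mem ψ (mem_image_of_mem _ hxcell))
        refine ⟨z, facesSpace_mono subset_union_left hz𝒢, hinjψ ?_⟩
        rw [← hβK z (Or.inl hz𝒢), hzy]
      · exact ⟨z, facesSpace_mono subset_union_right hz, hinjψ hzy⟩
    obtain ⟨z, hz, hzx⟩ := hz
    rcases hAfsep j hj x hx z hz hzx with h | ⟨G, hG⟩
    · left
      rwa [hTimg_eq j hj, hapexI_eq j hj]
    · exact Or.inr ⟨G, hG⟩
  -- package the singular data over one fixed finite index type (the largest family)
  have hfin_top : (𝒢all l.length).Finite := h𝒢all_fin l.length le_rfl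
  haveI : Fintype ↥(𝒢all l.length) := hfin_top.fintype
  have hmono_top : ∀ j ≤ l.length, 𝒢all j ⊆ 𝒢all l.length := fun j hj =>
    union_subset_union Subset.rfl (h𝒢loc_mono j l.length hj)
  obtain ⟨A, hA, hsep'⟩ : ∃ A : ℕ → ↥(𝒢all l.length) → AffineSubspace ℝ E,
      (∀ j < l.length, ∀ ℓ, (A j ℓ : Set E).Nonempty → finrank ℝ (A j ℓ).direction + 2 ≤ r) ∧
      (∀ j < l.length, ∀ y ∈ convexHull ℝ (Timg j : Set E), ψ y ∈ Cseq j →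
        y ∈ simplexHorn (Timg j) (apexI j) ∨ ∃ ℓ, y ∈ A j ℓ) := by
    refine ⟨fun (j : ℕ) (ℓ : ↥(𝒢all l.length)) =>
      if h : j < l.length ∧ (ℓ : Finset (E × ℝ)) ∈ 𝒢all j then Af j h.1 ⟨ℓ, h.2⟩ else ⊥, ?_, ?_⟩
    · intro j hj ℓ hℓ
      by_cases h : j < l.length ∧ (ℓ : Finset (E × ℝ)) ∈ 𝒢all j
      · have heq : (fun (j : ℕ) (ℓ : ↥(𝒢all l.length)) =>
            if h : j < l.length ∧ (ℓ : Finset (E × ℝ)) ∈ 𝒢all j then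
            Af j h.1 ⟨ℓ, h.2⟩ else (⊥ : AffineSubspace ℝ E)) j ℓ = Af j h.1 ⟨ℓ, h.2⟩ := dif_pos h
        rw [heq] at hℓ ⊢
        exact hAfdim j h.1 _ hℓ
      · have heq : (fun (j : ℕ) (ℓ : ↥(𝒢all l.length)) =>
            if h : j < l.length ∧ (ℓ : Finset (E × ℝ)) ∈ 𝒢all j then
            Af j h.1 ⟨ℓ, h.2⟩ else (⊥ : AffineSubspace ℝ E)) j ℓ = ⊥ := dif_neg h
        rw [heq] at hℓ
        exact absurd hℓ (by simp)
    · intro j hj y hy hyC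
      rcases hsep j hj y hy hyC with h | ⟨ℓ, hℓ⟩
      · exact Or.inl h
      · have hℓ' : (ℓ : Finset (E × ℝ)) ∈ 𝒢all l.length := hmono_top j hj.le ℓ.2
        refine Or.inr ⟨⟨ℓ.1, hℓ'⟩, ?_⟩
        have h : j < l.length ∧ (ℓ.1 : Finset (E × ℝ)) ∈ 𝒢all j := ⟨hj, ℓ.2⟩
        have heq : (fun (j : ℕ) (ℓ : ↥(𝒢all l.length)) =>
            if h : j < l.length ∧ (ℓ : Finset (E × ℝ)) ∈ 𝒢all j then
            Af j h.1 ⟨ℓ, h.2⟩ else (⊥ : AffineSubspace ℝ E)) j ⟨ℓ.1, hℓ'⟩ = Af j h.1 ⟨ℓ.1, h.2⟩ :=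
          dif_pos h
        rw [heq]
        exact hℓ
  -- the initial covering
  have hfs0 : facesSpace (𝒢loc 0) ⊆ facesSpace 𝒢₀ := by
    intro p hp
    obtain ⟨F, hF, hpF⟩ := mem_facesSpace_iff.1 hp
    have : p ∈ facesSpace (prevFaces (simplexCx τ hind) l tl 1 ∅ 0 ∅ τ 0) :=
      mem_facesSpace_iff.2 ⟨F, hF.1, hpF⟩
    rw [facesSpace_prevFaces_zero_eq l hl hind h01] at this
    exact hhorn this
  have hH₀cov' : Cseq 0 ⊆ H₀ '' U := by
    rintro x ((hx | hx) | ⟨y, ⟨z, hz, rfl⟩, rfl⟩)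
    · exact hH₀cov (Or.inl hx)
    · exact hH₀cov (Or.inr hx)
    · have hz₀ := hfs0 hz
      rw [← hβK z (Or.inl hz₀)]
      exact hH₀cov (Or.inr (mem_image_of_mem β (h𝒢₀T hz₀)))
  -- run the expansion sequence
  obtain ⟨H, hHfix, hHsupp, hHcov⟩ := exists_homeomorph_expandSeq hr ψ hψ U hU hIH univ isOpen_univ
    l.length Timg apexI hTind hTa hTB (fun j _ => subset_univ _) Cseq (fun j hj => hCcpt j hj) hCmono
    hCsucc hChorn (fun _ => ↥(𝒢all l.length)) A hA hsep' (C' ∪ Φ)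
    (union_subset (fun x hx => Or.inl (Or.inl hx)) fun x hx => Or.inl (Or.inr (hΦ hx)))
    H₀ hH₀fix hH₀supp hH₀cov'
  refine ⟨H, hHfix, hHsupp, ?_⟩
  -- the final tracked set contains the small faces of the prism
  rintro x (hx | ⟨y, ⟨z, hz, rfl⟩, rfl⟩)
  · exact hHcov (Or.inl hx)
  · refine hHcov (Or.inr (mem_image_of_mem ψ (mem_image_of_mem _ ?_)))
    obtain ⟨F, ⟨hF, hFcard⟩, hzF⟩ := mem_facesSpace_iff.1 hz
    refine mem_facesSpace_iff.2 ⟨F, ⟨?_, hFcard⟩, hzF⟩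
    have h := prismFaces_subset_prevFaces_length (K := simplexCx τ hind) (L := l) (t := tl)
      (N := 1) (Sub := ∅) (a := 0) (D := ∅) (σ := τ)
    simp only [hτdef, faceList_toFinset_self] at h ⊢
    exact h hF

/-! ### A sequence of prism cells in admissible order -/

omit [FiniteDimensional ℝ E] [DecidableEq E] in
/-- The polyhedron of a union of face families. [folklore] -/
theorem facesSpace_union {𝒜 ℬ : Set (Finset (E × ℝ))} :
    facesSpace (𝒜 ∪ ℬ) = facesSpace 𝒜 ∪ facesSpace ℬ := by
  ext x
  simp only [mem_facesSpace_iff, mem_union]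
  constructor
  · rintro ⟨F, hF | hF, hx⟩
    · exact Or.inl ⟨F, hF, hx⟩
    · exact Or.inr ⟨F, hF, hx⟩
  · rintro (⟨F, hF, hx⟩ | ⟨F, hF, hx⟩)
    · exact ⟨F, Or.inl hF, hx⟩
    · exact ⟨F, Or.inr hF, hx⟩

omit [FiniteDimensional ℝ E] [DecidableEq E] in
/-- The polyhedron of an indexed union of face families. [folklore] -/
theorem facesSpace_iUnion₂ {Q : ℕ} {𝒜 : ℕ → Set (Finset (E × ℝ))} :
    facesSpace (⋃ q < Q, 𝒜 q) = ⋃ q < Q, facesSpace (𝒜 q) := by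
  ext x
  simp only [mem_facesSpace_iff, mem_iUnion, exists_prop]
  constructor
  · rintro ⟨F, ⟨q, hq, hF⟩, hx⟩
    exact ⟨q, hq, F, hF, hx⟩
  · rintro ⟨q, hq, F, hF, hx⟩
    exact ⟨F, ⟨q, hq, hF⟩, hx⟩

set_option maxHeartbeats 800000 in
/-- **Engulfing a sequence of prism cells in admissible order** (the cells of one block of the
refined structure, processed sub-slab by sub-slab and by increasing dimension).  The cells
`conv τ_q × [t' c_q, t' (c_q + 1)]`, `q < Q`, `τ_q = (lc q).toFinset`, are given with: their
prism faces in the PL complex `K` (in general position), the track `β = ψ ∘ plMap K g` on them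
and on the tracked polyhedron `|𝒢₀| ⊆ T`, the separation of the far track from every cell, the
**admissibility of the order** — the horn of cell `q` lies in `|𝒢₀|` together with the tracked
parts of the earlier cells, the tracked set meets cell `q` only in its horn, and earlier cells
meet cell `q` only in its horn — and a compact `C'` off the images of the cells.  Then the
homeomorphism `H₀` (fixing `C' ∪ Φ`, `Φ ⊆ β(T)`, with `C' ∪ β(T) ⊆ H₀(U)`) is improved to one
fixing `C' ∪ Φ` with `C' ∪ β(T)` and the images of the small faces of all the cells inside `H(U)`.
Proof: `exists_homeomorph_expandPrism` cell by cell.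
[cite: Rushing1973, proof of Thm. 4.12.1, Facts 2–4] -/
theorem exists_homeomorph_expandCells {n r : ℕ} (hr : r + 3 ≤ n) (hn : finrank ℝ E = n)
    (ψ : E → M) (hψ : IsOpenEmbedding ψ) (U : Set M) (hU : IsOpen U)
    (hIH : ∀ (e₀ : M ≃ₜ M) (KP : Geometry.SimplicialComplex ℝ E) (_ : KP.faces.Finite)
      (KQ : Set (Finset E)) (_ : KQ ⊆ KP.faces) (_ : ∀ s ∈ KQ, ∀ t ⊆ s, t.Nonempty → t ∈ KQ)
      (_ : ∀ s ∈ KP.faces, s.card ≤ n - 2) (_ : ∀ s ∈ KP.faces, s ∉ KQ → s.card ≤ r)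
      (_ : ψ '' facesSpace KQ ⊆ e₀ '' U) (C' : Set M) (_ : IsCompact C') (_ : C' ⊆ e₀ '' U),
      ∃ e : M ≃ₜ M, (∀ x ∈ ψ '' facesSpace KQ ∪ C', e x = x) ∧
        (∃ E₀ : Set M, IsCompact E₀ ∧ ∀ x, x ∉ E₀ → e x = x) ∧ ψ '' KP.space ⊆ e '' (e₀ '' U))
    -- the PL data in general position
    {K : Geometry.SimplicialComplex ℝ (E × ℝ)} (hK : K.faces.Finite) {g : E × ℝ → E}
    {V₀ S : Set (E × ℝ)} (hgp : RelGenPos V₀ S g)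
    (hfix : ∀ ρ ∈ K.faces, (ρ : Set (E × ℝ)) ⊆ V₀ → AffIndOn g ρ)
    (hemb : InjOn (plMap K g) (fixedSpace K V₀)) (hS : ∀ F ∈ K.faces, (F : Set (E × ℝ)) ⊆ S)
    -- the cells
    {t' : ℕ → ℝ} (ht' : StrictMono t') (Q : ℕ) (lc : ℕ → List E) (cc : ℕ → ℕ)
    (hlnd : ∀ q < Q, (lc q).Nodup)
    (hlind : ∀ q < Q, AffineIndependent ℝ ((↑) : ↥(lc q).toFinset → E))
    (hlne : ∀ q < Q, lc q ≠ []) (hllen : ∀ q < Q, (lc q).length ≤ r + 1)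
    (hfacesK : ∀ q < Q, ∀ ρ : Finset E, ρ.Nonempty → ρ ⊆ (lc q).toFinset →
      prismFaces (t' (cc q)) (t' (cc q + 1)) (faceList (lc q) ρ) ⊆ K.faces)
    -- the tracked data
    (𝒢₀ : Set (Finset (E × ℝ))) (h𝒢₀K : 𝒢₀ ⊆ K.faces)
    (h𝒢₀down : ∀ G ∈ 𝒢₀, ∀ t ∈ K.faces, t ⊆ G → t ∈ 𝒢₀) (h𝒢₀card : ∀ G ∈ 𝒢₀, G.card ≤ n - 2)
    (T : Set (E × ℝ)) (hTc : IsCompact T) (h𝒢₀T : facesSpace 𝒢₀ ⊆ T)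
    (β : E × ℝ → M)
    (hβc : ContinuousOn β (T ∪ ⋃ q < Q, prismCell (lc q).toFinset (t' (cc q)) (t' (cc q + 1))))
    (hβK : ∀ p ∈ facesSpace 𝒢₀ ∪ ⋃ q < Q, prismCell (lc q).toFinset (t' (cc q)) (t' (cc q + 1)),
      β p = ψ (plMap K g p))
    (hsep₀ : ∀ q < Q, ∀ z ∈ T,
      β z ∈ ψ '' (plMap K g '' prismCell (lc q).toFinset (t' (cc q)) (t' (cc q + 1))) →
      z ∈ facesSpace 𝒢₀)
    -- admissible order
    (hhorn : ∀ q < Q, prismLevel (lc q).toFinset (t' (cc q)) ∪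
      (⋃ v ∈ (lc q).toFinset, prismCell ((lc q).toFinset.erase v) (t' (cc q)) (t' (cc q + 1))) ⊆
      facesSpace 𝒢₀ ∪ ⋃ q' < q, prismSkel r (lc q').toFinset (t' (cc q')) (t' (cc q' + 1)))
    (hN1 : ∀ q < Q, T ∩ prismCell (lc q).toFinset (t' (cc q)) (t' (cc q + 1)) ⊆
      prismLevel (lc q).toFinset (t' (cc q)) ∪
        ⋃ v ∈ (lc q).toFinset, prismCell ((lc q).toFinset.erase v) (t' (cc q)) (t' (cc q + 1)))
    (hN2 : ∀ q < Q, ∀ q' < q,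
      prismCell (lc q').toFinset (t' (cc q')) (t' (cc q' + 1)) ∩
        prismCell (lc q).toFinset (t' (cc q)) (t' (cc q + 1)) ⊆
      prismLevel (lc q).toFinset (t' (cc q)) ∪
        ⋃ v ∈ (lc q).toFinset, prismCell ((lc q).toFinset.erase v) (t' (cc q)) (t' (cc q + 1)))
    (C' : Set M) (hC' : IsCompact C')
    (hC'cell : ∀ q < Q, Disjoint C'
      (ψ '' (plMap K g '' prismCell (lc q).toFinset (t' (cc q)) (t' (cc q + 1)))))
    (Φ : Set M) (hΦ : Φ ⊆ β '' T)
    (H₀ : M ≃ₜ M) (hH₀fix : ∀ x ∈ C' ∪ Φ, H₀ x = x)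
    (hH₀supp : ∃ E₀ : Set M, IsCompact E₀ ∧ ∀ x, x ∉ E₀ → H₀ x = x)
    (hH₀cov : C' ∪ β '' T ⊆ H₀ '' U) :
    ∃ H : M ≃ₜ M, (∀ x ∈ C' ∪ Φ, H x = x) ∧ (∃ E₀ : Set M, IsCompact E₀ ∧ ∀ x, x ∉ E₀ → H x = x) ∧
      C' ∪ β '' T ∪ (⋃ q < Q, ψ '' (plMap K g '' facesSpace
        {F | F ∈ prismFaces (t' (cc q)) (t' (cc q + 1)) (lc q) ∧ F.card ≤ n - 2})) ⊆ H '' U := by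
  classical
  -- notation for the cells
  set cell : ℕ → Set (E × ℝ) := fun q => prismCell (lc q).toFinset (t' (cc q)) (t' (cc q + 1))
    with hcell
  set small : ℕ → Set (Finset (E × ℝ)) := fun q =>
    {F | F ∈ prismFaces (t' (cc q)) (t' (cc q + 1)) (lc q) ∧ F.card ≤ n - 2} with hsmall
  have hslab : ∀ q, t' (cc q) < t' (cc q + 1) := fun q => ht' (Nat.lt_succ_self _)
  -- the prism faces of cell `q` are faces of `K`
  have hprismK : ∀ q < Q, prismFaces (t' (cc q)) (t' (cc q + 1)) (lc q) ⊆ K.faces := by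
    intro q hq
    have hne : (lc q).toFinset.Nonempty := by
      obtain ⟨v, rest, h⟩ := List.exists_cons_of_ne_nil (hlne q hq)
      exact ⟨v, by rw [h]; simp⟩
    have := hfacesK q hq _ hne Finset.Subset.rfl
    rwa [faceList_toFinset_self] at this
  have hsmallK : ∀ q < Q, small q ⊆ K.faces := fun q hq F hF => hprismK q hq hF.1
  have hsmall_cell : ∀ q < Q, facesSpace (small q) ⊆ cell q := by
    intro q hq p hp
    obtain ⟨F, hF, hpF⟩ := mem_facesSpace_iff.1 hp
    exact convexHull_subset_prismCell_of_mem_prismFaces (hslab q) (hlnd q hq) hF.1 hpF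
  have hsmall_cpt : ∀ q < Q, IsCompact (facesSpace (small q)) := fun q hq =>
    (hK.subset (hsmallK q hq)).isCompact_biUnion fun F _ => F.finite_toSet.isCompact_convexHull (𝕜 := ℝ)
  have hsmall_img : ∀ q < Q, β '' facesSpace (small q) = ψ '' (plMap K g '' facesSpace (small q)) := by
    intro q hq
    rw [image_image]
    refine image_congr fun p hp => hβK p (Or.inr (mem_iUnion₂.2 ⟨q, hq, hsmall_cell q hq hp⟩))
  -- the skeleton of an earlier cell lies in the polyhedron of its small faces
  have hskel_small : ∀ q < Q, prismSkel r (lc q).toFinset (t' (cc q)) (t' (cc q + 1)) ⊆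
      facesSpace (small q) := fun q hq =>
    prismSkel_subset_facesSpace_small hr (lc q) (hlnd q hq) (hllen q hq) (hslab q)
  -- induction on the number of processed cells
  suffices hind : ∀ q ≤ Q, ∃ H : M ≃ₜ M, (∀ x ∈ C' ∪ Φ, H x = x) ∧
      (∃ E₀ : Set M, IsCompact E₀ ∧ ∀ x, x ∉ E₀ → H x = x) ∧
      C' ∪ β '' T ∪ (⋃ q' < q, ψ '' (plMap K g '' facesSpace (small q'))) ⊆ H '' U from
    hind Q le_rfl
  intro q
  induction q with
  | zero =>
    intro _
    refine ⟨H₀, hH₀fix, hH₀supp, ?_⟩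
    rintro x (hx | hx)
    · exact hH₀cov hx
    · simp at hx
  | succ q ih =>
    intro hq
    have hqQ : q < Q := Nat.lt_of_succ_le hq
    obtain ⟨H, hHfix, hHsupp, hHcov⟩ := ih hqQ.le
    -- the data of the one-prism step for cell `q`
    set Tq : Set (E × ℝ) := T ∪ ⋃ q' < q, facesSpace (small q') with hTq
    set 𝒢q : Set (Finset (E × ℝ)) := 𝒢₀ ∪ ⋃ q' < q, small q' with h𝒢q
    have h𝒢qK : 𝒢q ⊆ K.faces := union_subset h𝒢₀K (iUnion₂_subset fun q' hq' =>
      hsmallK q' (hq'.trans hqQ))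
    have h𝒢q_down : ∀ G ∈ 𝒢q, ∀ t ∈ K.faces, t ⊆ G → t ∈ 𝒢q := by
      rintro G (hG | hG) t ht htG
      · exact Or.inl (h𝒢₀down G hG t ht htG)
      · obtain ⟨q', hq', hGq⟩ := mem_iUnion₂.1 hG
        exact Or.inr (mem_iUnion₂.2 ⟨q', hq', prismFaces_down_closed hGq.1 htG
          (K.nonempty_of_mem_faces ht), (Finset.card_le_card htG).trans hGq.2⟩)
    have h𝒢q_card : ∀ G ∈ 𝒢q, G.card ≤ n - 2 := by
      rintro G (hG | hG)
      · exact h𝒢₀card G hG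
      · obtain ⟨q', -, hGq⟩ := mem_iUnion₂.1 hG
        exact hGq.2
    have hfs𝒢q : facesSpace 𝒢q = facesSpace 𝒢₀ ∪ ⋃ q' < q, facesSpace (small q') := by
      rw [h𝒢q, facesSpace_union, facesSpace_iUnion₂]
    have h𝒢qT : facesSpace 𝒢q ⊆ Tq := by
      rw [hfs𝒢q]
      exact union_subset_union h𝒢₀T Subset.rfl
    have hTq_sub : Tq ⊆ T ∪ ⋃ q' < Q, cell q' := union_subset_union Subset.rfl
      (iUnion₂_subset fun q' hq' => (hsmall_cell q' (hq'.trans hqQ)).trans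
        (subset_iUnion₂ (s := fun q' _ => cell q') q' (hq'.trans hqQ)))
    have hTqc : IsCompact Tq := hTc.union ((finite_lt_nat q).isCompact_biUnion fun q' hq' =>
      hsmall_cpt q' (hq'.trans hqQ))
    have hβTq : ContinuousOn β Tq := hβc.mono hTq_sub
    have hβKq : ∀ p ∈ facesSpace 𝒢q ∪ cell q, β p = ψ (plMap K g p) := by
      rintro p (hp | hp)
      · rw [hfs𝒢q] at hp
        rcases hp with hp | hp
        · exact hβK p (Or.inl hp)
        · obtain ⟨q', hq', hp'⟩ := mem_iUnion₂.1 hp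
          exact hβK p (Or.inr (mem_iUnion₂.2 ⟨q', hq'.trans hqQ, hsmall_cell q' (hq'.trans hqQ) hp'⟩))
      · exact hβK p (Or.inr (mem_iUnion₂.2 ⟨q, hqQ, hp⟩))
    have hsepq : ∀ z ∈ Tq, β z ∈ ψ '' (plMap K g '' cell q) → z ∈ facesSpace 𝒢q := by
      rintro z (hz | hz) hβz
      · rw [hfs𝒢q]
        exact Or.inl (hsep₀ q hqQ z hz hβz)
      · rw [hfs𝒢q]
        exact Or.inr hz
    have hhornq : prismLevel (lc q).toFinset (t' (cc q)) ∪
        (⋃ v ∈ (lc q).toFinset, prismCell ((lc q).toFinset.erase v) (t' (cc q)) (t' (cc q + 1))) ⊆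
        facesSpace 𝒢q := by
      refine (hhorn q hqQ).trans ?_
      rw [hfs𝒢q]
      refine union_subset_union Subset.rfl (iUnion₂_subset fun q' hq' => ?_)
      exact (hskel_small q' (hq'.trans hqQ)).trans
        (subset_iUnion₂ (s := fun q' _ => facesSpace (small q')) q' hq')
    -- the levels of cell `q` as a strictly increasing sequence
    obtain ⟨tl, htl, h0, h1⟩ : ∃ tl : ℕ → ℝ, StrictMono tl ∧ tl 0 = t' (cc q) ∧ tl 1 = t' (cc q + 1) := by
      refine ⟨fun k => t' (cc q) + k * (t' (cc q + 1) - t' (cc q)), ?_, by simp, by simp⟩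
      refine strictMono_nat_of_lt_succ fun k => ?_
      have := hslab q
      push_cast
      nlinarith
    -- newness of the staircase simplices and free faces of cell `q`
    have hcellq : ∀ i < (lc q).length, convexHull ℝ (stair (tl 0) (tl 1) (lc q) i : Set (E × ℝ)) ⊆
        cell q := fun i hi => by
      rw [h0, h1]
      exact convexHull_subset_prismCell_of_mem_prismFaces (hslab q) (hlnd q hqQ)
        ⟨⟨_, liftV_bot_getElem_mem_stair (lc q) i hi⟩, i, hi, Finset.Subset.rfl⟩
    have hhorn_prev : ∀ i ≤ (lc q).length, prismLevel (lc q).toFinset (t' (cc q)) ∪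
        (⋃ v ∈ (lc q).toFinset, prismCell ((lc q).toFinset.erase v) (t' (cc q)) (t' (cc q + 1))) ⊆
        facesSpace (prevFaces (simplexCx (lc q).toFinset (hlind q hqQ)) (lc q) tl 1 ∅ 0 ∅
          (lc q).toFinset i) := by
      intro i hi
      rw [← h0, ← h1, ← facesSpace_prevFaces_zero_eq (lc q) (hlnd q hqQ) (hlind q hqQ) (htl Nat.one_pos)]
      exact facesSpace_mono (prevFaces_mono_onePrism (Nat.zero_le i))
    have hnot_sub : ∀ i < (lc q).length, ∀ X : Set (E × ℝ),
        X ⊆ convexHull ℝ (stair (tl 0) (tl 1) (lc q) i : Set (E × ℝ)) →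
        ¬ X ⊆ facesSpace (prevFaces (simplexCx (lc q).toFinset (hlind q hqQ)) (lc q) tl 1 ∅ 0 ∅
          (lc q).toFinset i) →
        ∀ F ∈ 𝒢q, ¬ (X ⊆ convexHull ℝ (F : Set (E × ℝ)) ∧ convexHull ℝ (F : Set (E × ℝ)) ⊆ X) := by
      -- if `X = conv F` for a tracked `F`, then `X ⊆ T ∩ cell q` or `X ⊆ cell q' ∩ cell q`: in the horn
      intro i hi X hXR hXnot F hF ⟨hXF, hFX⟩
      apply hXnot
      refine Subset.trans ?_ (hhorn_prev i hi.le)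
      rcases hF with hF | hF
      · -- tracked far face: inside `T`
        have hXT : X ⊆ T := hXF.trans fun p hp => h𝒢₀T (mem_facesSpace_iff.2 ⟨F, hF, hp⟩)
        exact fun p hp => hN1 q hqQ ⟨hXT hp, hXR.trans (hcellq i hi) hp⟩
      · obtain ⟨q', hq', hFq⟩ := mem_iUnion₂.1 hF
        have hXc : X ⊆ cell q' := hXF.trans (convexHull_subset_prismCell_of_mem_prismFaces
          (hslab q') (hlnd q' (hq'.trans hqQ)) hFq.1)
        exact fun p hp => hN2 q hqQ q' hq' ⟨hXc hp, hXR.trans (hcellq i hi) hp⟩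
    have hnewq : ∀ (i : ℕ) (hi : i < (lc q).length), stair (tl 0) (tl 1) (lc q) i ∉ 𝒢q ∧
        (stair (tl 0) (tl 1) (lc q) i).erase (liftV (tl 0) (lc q)[i]) ∉ 𝒢q := by
      intro i hi
      constructor
      · intro hmem
        exact hnot_sub i hi _ Subset.rfl
          (not_convexHull_stair_subset (lc q) (hlnd q hqQ) (hlind q hqQ) htl i hi) _ hmem
          ⟨Subset.rfl, Subset.rfl⟩
      · intro hmem
        have hsub : convexHull ℝ (((stair (tl 0) (tl 1) (lc q) i).erase (liftV (tl 0) (lc q)[i]) :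
            Finset (E × ℝ)) : Set (E × ℝ)) ⊆ convexHull ℝ (stair (tl 0) (tl 1) (lc q) i : Set (E × ℝ)) :=
          convexHull_mono (by rw [Finset.coe_erase]; exact sdiff_subset)
        exact hnot_sub i hi _ hsub
          (not_convexHull_eraseBot_subset (lc q) (hlnd q hqQ) (hlind q hqQ) htl i hi) _ hmem
          ⟨Subset.rfl, Subset.rfl⟩
    -- faces of the sub-prisms of cell `q` are faces of `K`, in terms of `tl`
    have hfacesKq : ∀ ρ : Finset E, ρ.Nonempty → ρ ⊆ (lc q).toFinset →
        prismFaces (tl 0) (tl 1) (faceList (lc q) ρ) ⊆ K.faces := by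
      intro ρ hρ hρτ
      rw [h0, h1]
      exact hfacesK q hqQ ρ hρ hρτ
    have hcellq' : prismCell (lc q).toFinset (tl 0) (tl 1) = cell q := by rw [h0, h1]
    -- coverage of the enlarged tracked set
    have hcovq : C' ∪ β '' Tq ⊆ H '' U := by
      rintro x (hx | ⟨z, hz, rfl⟩)
      · exact hHcov (Or.inl (Or.inl hx))
      · rcases hz with hz | hz
        · exact hHcov (Or.inl (Or.inr (mem_image_of_mem β hz)))
        · obtain ⟨q', hq', hz'⟩ := mem_iUnion₂.1 hz
          refine hHcov (Or.inr (mem_iUnion₂.2 ⟨q', hq', ?_⟩))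
          rw [← hsmall_img q' (hq'.trans hqQ)]
          exact mem_image_of_mem β hz'
    -- the one-prism step
    obtain ⟨H', hH'fix, hH'supp, hH'cov⟩ := exists_homeomorph_expandPrism hr hn ψ hψ U hU hIH hK hgp
      hfix hemb hS (lc q) (hlnd q hqQ) (hlind q hqQ) (hlne q hqQ) (hllen q hqQ) htl hfacesKq 𝒢q
      h𝒢qK h𝒢q_down h𝒢q_card Tq hTqc h𝒢qT β hβTq (by rw [hcellq']; exact hβKq)
      (by rw [hcellq']; exact hsepq) (by rw [h0, h1]; exact hhornq) hnewq C' hC'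
      (by rw [hcellq']; exact hC'cell q hqQ) Φ (hΦ.trans (image_mono subset_union_left))
      H hHfix hHsupp hcovq
    refine ⟨H', hH'fix, hH'supp, ?_⟩
    rw [h0, h1] at hH'cov
    rintro x ((hx | hx) | hx)
    · exact hH'cov (Or.inl (Or.inl hx))
    · exact hH'cov (Or.inl (Or.inr (image_mono subset_union_left hx)))
    · obtain ⟨q', hq', hx'⟩ := mem_iUnion₂.1 hx
      rcases (Nat.lt_succ_iff.1 hq').lt_or_eq with hq'' | rfl
      · refine hH'cov (Or.inl (Or.inr ?_))
        rw [← hsmall_img q' (hq''.trans hqQ)] at hx'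
        exact image_mono (subset_union_right.trans' (subset_iUnion₂ (s := fun q' _ =>
          facesSpace (small q')) q' hq'')) hx'
      · exact hH'cov (Or.inr hx')

end Literature.Topology.FourManifolds

end
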